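import Mathlib
import Summits.ResolutionOfSingularities.ResolutionOfSingularities.Theorems.RadicialJungCleanModelsContactChainSimpleContaining
import Summits.ResolutionOfSingularities.ResolutionOfSingularities.Theorems.RadicialJungCleanModelsContactNormalForm
import HarnessLib

/-!
# Route `RadicialJung`, crux `CleanModels` (stmt-ResolutionOfSingularities-15917), line `Sketch` rev 35, stub 6 `stub_cleanProp44` (X44c),
# work plan O8 / L7b: EXISTENCE of the simple normal form consumed by `cleanPermissibleAt_of_pointChain_simpleContaining`

✓ `cleanPermissibleAt_of_pointChain_simpleContaining` (p812527) takes an element of the curve ideal in the explicit shape `Σ_i (w^j μ_i + π_i) t_i` with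
some `μ_i` a unit.  This file produces that shape from the natural data «`R = λ₁ t₁ + λ₂ t₂` with some `λ_i ∉ 𝓘_C`» (i.e. `R` simple along the curve
generically): take the contact normal forms `λ_i = γ_i w^{k_i} + π_i` of the coefficients outside `𝓘_C` (`exists_contact_normalForm`), `j := ` the
least such `k_i`, `μ_i := γ_i w^{k_i − j}` (a unit exactly at the minimum) and `μ_i := 0` for coefficients inside `𝓘_C`.
* `exists_simple_normalForm`.

Honest framing: OURS (bookkeeping); nothing here proves resolution in characteristic `p`, X44c, or any case of `CleanModels`.
-/

noncomputable section

set_option linter.dupNamespace false -- mandated namespace of this single-conjunct summit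

open IsLocalRing
open Literature.AlgebraicGeometry.Resolution

universe u

namespace Summit.ResolutionOfSingularities.ResolutionOfSingularities.Theorems.RadicialJung.CleanModels

/-- **Existence of the simple normal form.**  `A` Noetherian local, `P` an ideal, `w` with `P + (w) = 𝔪`, `t : Fin 2 → A`; an element
`R = λ₀ t₀ + λ₁ t₁` with `λ_{i₀} ∉ P` can be written `R = Σ_i (w^j μ_i + π_i) t_i` with `μ_{i}` a unit for some `i` and `π_i ∈ P`.
[cite: Matsumura1987, Thm. 8.10] -/
theorem exists_simple_normalForm {A : Type u} [CommRing A] [IsLocalRing A] [IsNoetherianRing A] (P : Ideal A) (w : A)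
    (hw : P ⊔ Ideal.span {w} = maximalIdeal A) (t : Fin 2 → A) (lam : Fin 2 → A) {i₀ : Fin 2} (hi₀ : lam i₀ ∉ P) :
    ∃ (j : ℕ) (μ π : Fin 2 → A), (∃ i, IsUnit (μ i)) ∧ (∀ i, π i ∈ P) ∧
      (∑ i, lam i * t i) = ∑ i, (w ^ j * μ i + π i) * t i := by
  classical
  -- contact normal forms of the coefficients outside `P` (and the trivial form `0 · w^0 + λ` inside)
  have hnf : ∀ i, ∃ (k : ℕ) (γ π : A), π ∈ P ∧ lam i = γ * w ^ k + π ∧ (lam i ∉ P → IsUnit γ) ∧ (lam i ∈ P → γ = 0) := by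
    intro i
    by_cases hi : lam i ∈ P
    · exact ⟨0, 0, lam i, hi, by ring, fun h => absurd hi h, fun _ => rfl⟩
    · obtain ⟨k, γ, π, hγ, hπ, hs⟩ := exists_contact_normalForm P w hw (lam i) hi
      exact ⟨k, γ, π, hπ, hs, fun _ => hγ, fun h => absurd h hi⟩
  choose k γ π hπ hlam hγunit hγzero using hnf
  -- the other index
  obtain ⟨i₁, hi₁⟩ : ∃ i₁ : Fin 2, i₁ ≠ i₀ := ⟨i₀ + 1, by fin_cases i₀ <;> simp⟩
  have huniv : (Finset.univ : Finset (Fin 2)) = {i₀, i₁} := by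
    ext i; fin_cases i <;> fin_cases i₀ <;> fin_cases i₁ <;> simp_all
  -- case split on whether the other coefficient is inside `P` or has smaller contact
  by_cases h1 : lam i₁ ∈ P ∨ k i₀ ≤ k i₁
  · -- `j := k i₀`
    refine ⟨k i₀, fun i => if i = i₀ then γ i₀ else (if lam i₁ ∈ P then 0 else γ i₁ * w ^ (k i₁ - k i₀)), π,
      ⟨i₀, by simpa using hγunit i₀ hi₀⟩, hπ, ?_⟩
    rw [huniv, Finset.sum_pair hi₁.symm, Finset.sum_pair hi₁.symm]
    simp only [ite_true, if_neg hi₁]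
    rcases h1 with hP | hle
    · rw [if_pos hP, hlam i₀, hlam i₁, hγzero i₁ hP]; ring
    · by_cases hP : lam i₁ ∈ P
      · rw [if_pos hP, hlam i₀, hlam i₁, hγzero i₁ hP]; ring
      · rw [if_neg hP, hlam i₀, hlam i₁]
        have : w ^ k i₁ = w ^ k i₀ * w ^ (k i₁ - k i₀) := by rw [← pow_add, Nat.add_sub_cancel' hle]
        rw [this]; ring
  · -- `λ_{i₁} ∉ P` with strictly smaller contact: `j := k i₁`
    push Not at h1
    obtain ⟨hP, hlt⟩ := h1
    refine ⟨k i₁, fun i => if i = i₁ then γ i₁ else γ i₀ * w ^ (k i₀ - k i₁), π, ⟨i₁, by simpa using hγunit i₁ hP⟩, hπ, ?_⟩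
    rw [huniv, Finset.sum_pair hi₁.symm, Finset.sum_pair hi₁.symm]
    simp only [ite_true, if_neg hi₁.symm]
    rw [hlam i₀, hlam i₁]
    have : w ^ k i₀ = w ^ k i₁ * w ^ (k i₀ - k i₁) := by rw [← pow_add, Nat.add_sub_cancel' hlt.le]
    rw [this]; ring

end Summit.ResolutionOfSingularities.ResolutionOfSingularities.Theorems.RadicialJung.CleanModels

end
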